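import Literature.MathematicalPhysics.QuantumFieldTheory.Balaban1983to89.B8LeafModelZd
import Literature.MathematicalPhysics.QuantumFieldTheory.Balaban1983to89.B8Prop5KLevelLetters

/-!
# `Balaban1983to89.B8LeafModelZdOfHFP` — [Balaban1985RegularSpaces] THEOREM 4 (p. 88) AS THE ABSTRACT LEAF `B8.Thm4Printed` ON THE
# GENERAL-BACKGROUND `ℤᵈ × 𝔸` FAMILY `zdGF`, WITH THE TWO PROPOSITION-5 EXISTENCE SOCKETS REPLACED BY THE FIXED POINT IN PLAIN CURRENCY

statement-level skeleton of published theorems with citation tags; proofs where landed; nothing here is a claim about the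
Yang–Mills mass gap

PDF held: `paper:balaban1985-cmp99-regular-spaces-gauge-fixing` (journal page = PDF page + 74); pp. 88–89, 93–95.

WHY THIS FILE (cell `pub-ymgap`, seat `pub-ymgap-dag-n05-a` g5, KNIT seat of DAG node N05 = [B8]; count-neutral).  `B8LeafModelZd`
(g4) proved `B8.Thm4Printed (5dLB₀) zdGF` modulo four NAMED sockets, two of which — `SockP5base`, `SockP5` — are Proposition 5's
EXISTENCE statement in the «support form» the Theorem-4 driver reads (a unitary `v`, `= 1` off `Ω₀`, reading `e^{iλ}` on the bonds,
(1.108), the Landau condition of record (1.38) for `U₁^{v⁻¹}` at `m + 1` levels, (1.29) for `u₁·v`).  Seat `pub-ymgap-dag-n04-b`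
(№41-a, `B8Prop5KLevelLetters` §4, `B8Thm4ExistsModHFP`) showed that this support form FOLLOWS from the fixed point of (1.106)/(1.107)
displayed in PLAIN currency — `λ` Hermitian, `λ = 0` off `Ω₀` ((1.109)), the bounds (1.108) at the `m + 1` levels, the Lagrange-
multiplier form of the Landau equation for the right-hand side of the D*-identity (1.86)–(1.88), and (1.29) for `u₁·e^{iλ}` (Sect. E) —
which is exactly the output currency of the k-level contraction (`B8Prop5ContractionKLevel`, seat `pub-ymgap-dag-n19-b`, №41-b).
This file moves that reduction to the LEAF: it names the two plain-currency sockets `SockHFP₀` / `SockHFP` (same guard as the g4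
sockets), proves the socket adapters `sockP5base_of_sockHFP₀` / `sockP5_of_sockHFP` (by `hP5base_of_HFP` / `hP5_of_HFP` under the
first four windows of `B8Thm4Windows.thm4_windows`), the antitonicity of every socket in its threshold, and
**`thm4Printed_zd_of_HFP : B8.Thm4Printed (5dLB₀) (fun i => zdGF 𝔸 L i)`** modulo `SockHFP₀` / `SockHFP` / `SockH59` / `SockP5u` — and the
same with four INDEPENDENT provider thresholds (`thm4Printed_zd_of_HFP₄`), which is the form the providers deliver.

HONEST SCOPE.  Bookkeeping at the socket level; nothing of Proposition 5 (the contraction, the letters `G′, C, H′` of [4]), of Sect. E,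
or of [4] Theorem 3.3 is proved here; the fixed point (`SockHFP₀`/`SockHFP`), Prop. 5's uniqueness clause (`SockP5u`) and the in-edge b9
(`SockH59`) remain hypotheses quantified over the members.  Count-neutral; N05 NOT discharged; nothing continuum / ℝ⁴ / OS / mass-gap /
Clay.  Unit `pub-ymgap-dag-n05-a` (g5), 2026-08-26.
-/

noncomputable section

open NormedSpace

namespace Literature.MathematicalPhysics.QuantumFieldTheory.Balaban1983to89.B8LeafModelZdOfHFP

open MatrixLog B7Prop1Explicit B7Prop2Explicit B7Prop1Local B7Eq92Concrete
open B7Eq78Linearization (conjR)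
open B8Ineq132 (covDerivFwd InAk)
open B8Eq119TwistedAxial (Restr129 InAx)
open B8Eq182Proof (gAd)
open B8Eq184Proof (gaugeExp cfgExp)
open B8Eq188Proof (frakF3)
open B8Lemma1NonAbelian (mulCfg)
open B8Eq140Level (SideTouches)
open B8Eq138LandauZd (covDivB covLap QT IsLandau138W)
open B8Prop5KLevelLetters (hP5base_of_HFP hP5_of_HFP)
open B8Thm4Windows (thm4_windows)
open B8LeafModelZd (SockP5base SockP5 SockH59 SockP5u ZdIdx zdGF thm4Printed_zd)

-- `Site` alone could resolve to the torus sites of `Setup.lean`; re-export the `ℤ^d` sites of `B7Prop1Explicit`.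
export B7Prop1Explicit (Site)

variable {d : ℕ}

/-! ## §1 The Proposition-5 fixed point in PLAIN currency, as guarded sockets (`HFP₀`, `HFP` of `B8Thm4ExistsModHFP`) -/

section Sockets

variable {𝔸 : Type*} [CStarAlgebra 𝔸] [Nontrivial 𝔸]

/-- **The Proposition-5 FIXED-POINT socket at the base level, plain currency** (`HFP₀` of
`B8Thm4ExistsModHFP.thm4_exists_all_levels_supp_of_HFP`, under the guard of `B8LeafModelZd.SockP5base`): for the datum of level `0`
(`u₁ = 1`, `U₁ = U′ = e^{iηA}` on the sides of the plaquettes touching `Ω₀`, `A` Hermitian, `|A| ≤ c⋆η⁻¹`, `c⋆ = 5dLB₀(α₀ + α₁)`) there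
is `λ` Hermitian, `= 0` off `Ω₀` ((1.109)), with (1.108) at levels `≤ 1` for `α₄ = 8B₀′·5dLB₀·(α₀ + α₁)`, the multiplier form of the
Landau equation `Δ↾Ω₀[D*A + Δλ + 𝔑(λ)] = Q′ᵀμ` on `Ω₀` at `1` level, and (1.29) at `1` level for `1·e^{iλ}`.
[cite: Balaban1985RegularSpaces, Prop. 5 (1.106)–(1.109) p.94, (1.86)–(1.88) p.91, p.89] -/
def SockHFP₀ (L : ℕ) (B₀ B₀' cP : ℝ) (η : ℝ) (k : ℕ) (Ω : ℕ → Set (Site d)) (Λs : ℕ → ℕ → Set (Site d)) : Prop :=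
  ∀ α₀ α₁ : ℝ, 0 < α₀ → 0 < α₁ → α₀ + α₁ ≤ cP →
      ∀ U₀ U' : Site d → Fin d → 𝔸ˣ, (∀ x κ, U₀ x κ ∈ unitaryUnits 𝔸) → (∀ x κ, U' x κ ∈ unitaryUnits 𝔸) →
      InAk L k η α₀ Ω U₀ → InAk L k η α₀ Ω (mulCfg U' U₀) → (∀ m, m ≤ k → InAx L m (Λs m) U₀ (mulCfg U' U₀)) →
      (∀ j, j ≤ k → ∀ (z : Site d) (μ : Fin d), (∀ x, InBox (loK L j z) (bondHiK L j z μ) x → x ∈ Ω j) →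
        ‖(avgIter L (mulCfg U' U₀) j z μ : 𝔸) - (avgIter L U₀ j z μ : 𝔸)‖ ≤ α₁) →
      (∀ b ∈ {b : Site d × Fin d | SideTouches (Ω 0) b.1 b.2}, ‖((U' b.1 b.2 : 𝔸ˣ) : 𝔸) - 1‖ ≤ α₁) →
      ∀ A : Site d → Fin d → 𝔸,
      (∀ j, j ≤ 0 → ∀ b ∈ {b : Site d × Fin d | SideTouches (Ω j) b.1 b.2},
        U' b.1 b.2 = cfgExp η A b.1 b.2 ∧ IsSelfAdjoint (A b.1 b.2) ∧
          ‖A b.1 b.2‖ ≤ (5 * (d : ℝ) * L * B₀ * (α₀ + α₁)) * ((L : ℝ) ^ j * η)⁻¹) →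
      ∃ lam : Site d → 𝔸, (∀ x, IsSelfAdjoint (lam x)) ∧ (∀ x, x ∉ Ω 0 → lam x = 0) ∧
        (∀ j, j ≤ 1 → ∀ b ∈ {b : Site d × Fin d | SideTouches (Ω j) b.1 b.2},
          ‖lam b.1‖ ≤ (8 * B₀' * (5 * (d : ℝ) * L * B₀) * (α₀ + α₁)) ∧
            ((L : ℝ) ^ j * η) * ‖covDerivFwd η U₀ b.2 lam b.1‖ ≤ (8 * B₀' * (5 * (d : ℝ) * L * B₀) * (α₀ + α₁))) ∧
        (∃ μ : ℕ → Site d → 𝔸, ∀ x ∈ Ω 0,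
          covLap η U₀ ((Ω 0).indicator fun y => covDivB η U₀ A y + covLap η U₀ lam y +
            ((conjR (gaugeExp lam y)⁻¹ (covDivB η U₀ A y) - covDivB η U₀ A y) +
              (gAd (covLap η U₀ lam y) (lam y) - covLap η U₀ lam y) + ∑ μ, frakF3 η U₀ lam A y μ)) x =
            QT L 1 (Λs 1) U₀ μ x) ∧
        Restr129 L 1 (Λs 1) U₀ ((1 : Site d → 𝔸ˣ) * gaugeExp lam)

/-- **The Proposition-5 FIXED-POINT socket at level `m + 1`, plain currency** (`HFP` of
`B8Thm4ExistsModHFP.thm4_exists_all_levels_supp_of_HFP`, under the guard of `B8LeafModelZd.SockP5`): for every level-`m` datum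
`(u₁, U₁ = U′^{u₁⁻¹}, A)` of Theorem 4's induction (`1 ≤ m < k`; `u₁` unitary, `= 1` off `Ω₀`, (1.29) at `m` levels, the Landau
condition of record for `U₁`, `U₁ = e^{iηA}` on the sides of the plaquettes touching `Ω_j` with `|A| ≤ c⋆(Lʲη)⁻¹`) there is `λ`
Hermitian, `= 0` off `Ω₀`, with (1.108) at the `m + 1` levels, the multiplier form of the Landau equation at `m + 1` levels and (1.29)
at `m + 1` levels for `u₁·e^{iλ}`. [cite: Balaban1985RegularSpaces, Prop. 5 (1.106)–(1.109) p.94, Thm 4 p.88, pp.94–95] -/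
def SockHFP (L : ℕ) (B₀ B₀' cP : ℝ) (η : ℝ) (k : ℕ) (Ω : ℕ → Set (Site d)) (Λs : ℕ → ℕ → Set (Site d)) : Prop :=
  ∀ α₀ α₁ : ℝ, 0 < α₀ → 0 < α₁ → α₀ + α₁ ≤ cP →
      ∀ U₀ U' : Site d → Fin d → 𝔸ˣ, (∀ x κ, U₀ x κ ∈ unitaryUnits 𝔸) → (∀ x κ, U' x κ ∈ unitaryUnits 𝔸) →
      InAk L k η α₀ Ω U₀ → InAk L k η α₀ Ω (mulCfg U' U₀) → (∀ m, m ≤ k → InAx L m (Λs m) U₀ (mulCfg U' U₀)) →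
      (∀ j, j ≤ k → ∀ (z : Site d) (μ : Fin d), (∀ x, InBox (loK L j z) (bondHiK L j z μ) x → x ∈ Ω j) →
        ‖(avgIter L (mulCfg U' U₀) j z μ : 𝔸) - (avgIter L U₀ j z μ : 𝔸)‖ ≤ α₁) →
      (∀ b ∈ {b : Site d × Fin d | SideTouches (Ω 0) b.1 b.2}, ‖((U' b.1 b.2 : 𝔸ˣ) : 𝔸) - 1‖ ≤ α₁) →
      ∀ m, 1 ≤ m → m < k → ∀ (u₁ : Site d → 𝔸ˣ) (U₁ : Site d → Fin d → 𝔸ˣ) (A : Site d → Fin d → 𝔸),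
      (∀ x, u₁ x ∈ unitaryUnits 𝔸) → (∀ x, x ∉ Ω 0 → u₁ x = 1) → mgauge U₀ u₁ U₁ = U' → Restr129 L m (Λs m) U₀ u₁ →
      IsLandau138W L m η (Ω 0) (Λs m) U₀ U₁ →
      (∀ j, j ≤ m → ∀ b ∈ {b : Site d × Fin d | SideTouches (Ω j) b.1 b.2},
        U₁ b.1 b.2 = cfgExp η A b.1 b.2 ∧ IsSelfAdjoint (A b.1 b.2) ∧
          ‖A b.1 b.2‖ ≤ (5 * (d : ℝ) * L * B₀ * (α₀ + α₁)) * ((L : ℝ) ^ j * η)⁻¹) →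
      ∃ lam : Site d → 𝔸, (∀ x, IsSelfAdjoint (lam x)) ∧ (∀ x, x ∉ Ω 0 → lam x = 0) ∧
        (∀ j, j ≤ m + 1 → ∀ b ∈ {b : Site d × Fin d | SideTouches (Ω j) b.1 b.2},
          ‖lam b.1‖ ≤ (8 * B₀' * (5 * (d : ℝ) * L * B₀) * (α₀ + α₁)) ∧
            ((L : ℝ) ^ j * η) * ‖covDerivFwd η U₀ b.2 lam b.1‖ ≤ (8 * B₀' * (5 * (d : ℝ) * L * B₀) * (α₀ + α₁))) ∧
        (∃ μ : ℕ → Site d → 𝔸, ∀ x ∈ Ω 0,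
          covLap η U₀ ((Ω 0).indicator fun y => covDivB η U₀ A y + covLap η U₀ lam y +
            ((conjR (gaugeExp lam y)⁻¹ (covDivB η U₀ A y) - covDivB η U₀ A y) +
              (gAd (covLap η U₀ lam y) (lam y) - covLap η U₀ lam y) + ∑ μ, frakF3 η U₀ lam A y μ)) x =
            QT L (m + 1) (Λs (m + 1)) U₀ μ x) ∧
        Restr129 L (m + 1) (Λs (m + 1)) U₀ (u₁ * gaugeExp lam)

end Sockets

/-! ## §2 Antitonicity of every socket in its threshold (a provider below a smaller threshold serves a fortiori) -/

section Anti

variable {𝔸 : Type*} [CStarAlgebra 𝔸]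

/-- `SockHFP₀` is antitone in the threshold `cP`. [cite: Balaban1985RegularSpaces, Prop. 5 p.94] -/
theorem sockHFP₀_anti {L : ℕ} {B₀ B₀' cP cP' : ℝ} (h : cP' ≤ cP) {η : ℝ} {k : ℕ} {Ω : ℕ → Set (Site d)}
    {Λs : ℕ → ℕ → Set (Site d)} (S : SockHFP₀ (𝔸 := 𝔸) L B₀ B₀' cP η k Ω Λs) : SockHFP₀ (𝔸 := 𝔸) L B₀ B₀' cP' η k Ω Λs :=
  fun α₀ α₁ hα₀ hα₁ hs => S α₀ α₁ hα₀ hα₁ (hs.trans h)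

/-- `SockHFP` is antitone in the threshold `cP`. [cite: Balaban1985RegularSpaces, Prop. 5 p.94] -/
theorem sockHFP_anti {L : ℕ} {B₀ B₀' cP cP' : ℝ} (h : cP' ≤ cP) {η : ℝ} {k : ℕ} {Ω : ℕ → Set (Site d)}
    {Λs : ℕ → ℕ → Set (Site d)} (S : SockHFP (𝔸 := 𝔸) L B₀ B₀' cP η k Ω Λs) : SockHFP (𝔸 := 𝔸) L B₀ B₀' cP' η k Ω Λs :=
  fun α₀ α₁ hα₀ hα₁ hs => S α₀ α₁ hα₀ hα₁ (hs.trans h)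

/-- `SockP5base` is antitone in the threshold `cP`. [cite: Balaban1985RegularSpaces, Prop. 5 p.94] -/
theorem sockP5base_anti {L : ℕ} {B₀ B₀' cP cP' : ℝ} (h : cP' ≤ cP) {η : ℝ} {k : ℕ} {Ω : ℕ → Set (Site d)}
    {Λs : ℕ → ℕ → Set (Site d)} (S : SockP5base (𝔸 := 𝔸) L B₀ B₀' cP η k Ω Λs) : SockP5base (𝔸 := 𝔸) L B₀ B₀' cP' η k Ω Λs :=
  fun α₀ α₁ hα₀ hα₁ hs => S α₀ α₁ hα₀ hα₁ (hs.trans h)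

/-- `SockP5` is antitone in the threshold `cP`. [cite: Balaban1985RegularSpaces, Prop. 5 p.94] -/
theorem sockP5_anti {L : ℕ} {B₀ B₀' cP cP' : ℝ} (h : cP' ≤ cP) {η : ℝ} {k : ℕ} {Ω : ℕ → Set (Site d)}
    {Λs : ℕ → ℕ → Set (Site d)} (S : SockP5 (𝔸 := 𝔸) L B₀ B₀' cP η k Ω Λs) : SockP5 (𝔸 := 𝔸) L B₀ B₀' cP' η k Ω Λs :=
  fun α₀ α₁ hα₀ hα₁ hs => S α₀ α₁ hα₀ hα₁ (hs.trans h)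

/-- `SockH59` is antitone in the threshold `cP`. [cite: Balaban1985RegularSpaces, (1.59) p.86] -/
theorem sockH59_anti {L : ℕ} {B₀ B₀' cP cP' : ℝ} (h : cP' ≤ cP) {η : ℝ} {k : ℕ} {Ω : ℕ → Set (Site d)}
    {Λs : ℕ → ℕ → Set (Site d)} {Λb : ℕ → ℕ → Set (Site d × Fin d)} (S : SockH59 (𝔸 := 𝔸) L B₀ B₀' cP η k Ω Λs Λb) :
    SockH59 (𝔸 := 𝔸) L B₀ B₀' cP' η k Ω Λs Λb :=
  fun α₀ α₁ hα₀ hα₁ hs => S α₀ α₁ hα₀ hα₁ (hs.trans h)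

/-- `SockP5u` is antitone in the threshold `cP`. [cite: Balaban1985RegularSpaces, Prop. 5 (1.109) p.94] -/
theorem sockP5u_anti {L : ℕ} {cP cP' cu : ℝ} (h : cP' ≤ cP) {η : ℝ} {k : ℕ} {Ω : ℕ → Set (Site d)}
    {Λs : ℕ → ℕ → Set (Site d)} (S : SockP5u (𝔸 := 𝔸) L cP cu η k Ω Λs) : SockP5u (𝔸 := 𝔸) L cP' cu η k Ω Λs :=
  fun α₀ α₁ hα₀ hα₁ hs => S α₀ α₁ hα₀ hα₁ (hs.trans h)

end Anti

/-! ## §3 The socket adapters: plain-currency fixed point ⇒ support form (n04-b's `hP5base_of_HFP` / `hP5_of_HFP` under the guard) -/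

section Adapters

/-- **The four windows the adapters read** (the first four conjuncts of `B8Thm4Windows.thm4_windows`): below ONE threshold
`c₁(d, L, B₀, B₀′) > 0`, `α₄ = 8B₀′·5dLB₀·(α₀ + α₁) ≤ 1/84`, `L·c⋆ ≤ 1/12`, `α₁ ≤ 1/4` and `2α₁ ≤ c⋆` (the last from `2 ≤ 5dLB₀`).
[cite: Balaban1985RegularSpaces, Thm 4 p.88 («there exists a constant c₁»), p.89 («B₁ not too small»), (1.108) p.94] -/
theorem windows4 {L : ℕ} (hd : 1 ≤ d) (hL : 1 ≤ L) {B₀ B₀' : ℝ} (hB₀ : 0 < B₀) (hB₀' : 0 < B₀')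
    (hB : 2 ≤ 5 * (d : ℝ) * L * B₀) :
    ∃ c₁ : ℝ, 0 < c₁ ∧ ∀ α₀ α₁ : ℝ, 0 < α₀ → 0 < α₁ → α₀ + α₁ ≤ c₁ →
      8 * B₀' * (5 * (d : ℝ) * L * B₀) * (α₀ + α₁) ≤ 1 / 84 ∧ L * (5 * (d : ℝ) * L * B₀ * (α₀ + α₁)) ≤ 1 / 12 ∧
        α₁ ≤ 1 / 4 ∧ 2 * α₁ ≤ 5 * (d : ℝ) * L * B₀ * (α₀ + α₁) := by
  obtain ⟨c₁, hc₁, hw⟩ := thm4_windows hd hL hB₀ hB₀' hB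
  refine ⟨c₁, hc₁, fun α₀ α₁ hα₀ hα₁ hs => ?_⟩
  obtain ⟨w1, w2, w3, w4, -⟩ := hw α₀ α₁ hα₀ hα₁ hs _ _ rfl rfl
  exact ⟨w1, w2, w3, w4⟩

variable {𝔸 : Type*} [CStarAlgebra 𝔸] [Nontrivial 𝔸]

/-- **`SockHFP₀ ⇒ SockP5base` below the window threshold**: the base-level Proposition-5 socket of the Theorem-4 driver in support
form, from the fixed point in plain currency, by `B8Prop5KLevelLetters.hP5base_of_HFP` (`v := e^{iλ}` unitary, `= 1` off `Ω₀`, (1.108),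
the Landau condition of record for `U′^{v⁻¹}` at `1` level by the D*-identity (1.86)–(1.88) and locality, (1.29) for `1·v`), the
smallness premises `α₄ ≤ 1/84`, `c⋆ ≤ 1/12`, `α₁ ≤ 1/4`, `2α₁ ≤ c⋆` being the windows `hwin` below `c₁ ≤ cP`.
[cite: Balaban1985RegularSpaces, Prop. 5 pp.93–94, (1.66) p.88, (1.106)–(1.110) p.94, p.89] -/
theorem sockP5base_of_sockHFP₀ (hd2 : 2 ≤ d) {η : ℝ} (hη : 0 < η) {L : ℕ} (hL : 1 ≤ L) {B₀ B₀' cP c₁ : ℝ} (hB₀ : 0 ≤ B₀)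
    (hc₁ : c₁ ≤ cP)
    (hwin : ∀ α₀ α₁ : ℝ, 0 < α₀ → 0 < α₁ → α₀ + α₁ ≤ c₁ →
      8 * B₀' * (5 * (d : ℝ) * L * B₀) * (α₀ + α₁) ≤ 1 / 84 ∧ L * (5 * (d : ℝ) * L * B₀ * (α₀ + α₁)) ≤ 1 / 12 ∧
        α₁ ≤ 1 / 4 ∧ 2 * α₁ ≤ 5 * (d : ℝ) * L * B₀ * (α₀ + α₁))
    {k : ℕ} {Ω : ℕ → Set (Site d)} {Λs : ℕ → ℕ → Set (Site d)} (S : SockHFP₀ (𝔸 := 𝔸) L B₀ B₀' cP η k Ω Λs) :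
    SockP5base (𝔸 := 𝔸) L B₀ B₀' c₁ η k Ω Λs := by
  intro α₀ α₁ hα₀ hα₁ hs U₀ U' hU₀ hU' h33 h34 hAx h135 h66
  obtain ⟨w1, w2, w3, w4⟩ := hwin α₀ α₁ hα₀ hα₁ hs
  have hL1 : (1 : ℝ) ≤ L := by exact_mod_cast hL
  have hcstar : 0 ≤ 5 * (d : ℝ) * L * B₀ * (α₀ + α₁) := by
    have : 0 ≤ α₀ + α₁ := by linarith
    positivity
  have hcs : 5 * (d : ℝ) * L * B₀ * (α₀ + α₁) ≤ 1 / 12 := le_trans (le_mul_of_one_le_left hcstar hL1) w2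
  exact hP5base_of_HFP hd2 hη L hU₀ hU' w1 hcs w3 w4 Ω Λs h66
    (S α₀ α₁ hα₀ hα₁ (hs.trans hc₁) U₀ U' hU₀ hU' h33 h34 hAx h135 h66)

/-- **`SockHFP ⇒ SockP5` below the window threshold**: the level-`m + 1` Proposition-5 socket of the Theorem-4 driver in support form,
from the fixed point in plain currency at every level `1 ≤ m < k`, by `B8Prop5KLevelLetters.hP5_of_HFP`; windows as in
`sockP5base_of_sockHFP₀`. [cite: Balaban1985RegularSpaces, Prop. 5 pp.93–94, (1.106)–(1.110) p.94, Thm 4 p.88] -/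
theorem sockP5_of_sockHFP (hd2 : 2 ≤ d) {η : ℝ} (hη : 0 < η) {L : ℕ} (hL : 1 ≤ L) {B₀ B₀' cP c₁ : ℝ} (hB₀ : 0 ≤ B₀)
    (hc₁ : c₁ ≤ cP)
    (hwin : ∀ α₀ α₁ : ℝ, 0 < α₀ → 0 < α₁ → α₀ + α₁ ≤ c₁ →
      8 * B₀' * (5 * (d : ℝ) * L * B₀) * (α₀ + α₁) ≤ 1 / 84 ∧ L * (5 * (d : ℝ) * L * B₀ * (α₀ + α₁)) ≤ 1 / 12 ∧
        α₁ ≤ 1 / 4 ∧ 2 * α₁ ≤ 5 * (d : ℝ) * L * B₀ * (α₀ + α₁))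
    {k : ℕ} {Ω : ℕ → Set (Site d)} {Λs : ℕ → ℕ → Set (Site d)} (S : SockHFP (𝔸 := 𝔸) L B₀ B₀' cP η k Ω Λs) :
    SockP5 (𝔸 := 𝔸) L B₀ B₀' c₁ η k Ω Λs := by
  intro α₀ α₁ hα₀ hα₁ hs U₀ U' hU₀ hU' h33 h34 hAx h135 h66
  obtain ⟨w1, w2, -, -⟩ := hwin α₀ α₁ hα₀ hα₁ hs
  have hL1 : (1 : ℝ) ≤ L := by exact_mod_cast hL
  have hcstar : 0 ≤ 5 * (d : ℝ) * L * B₀ * (α₀ + α₁) := by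
    have : 0 ≤ α₀ + α₁ := by linarith
    positivity
  have hcs : 5 * (d : ℝ) * L * B₀ * (α₀ + α₁) ≤ 1 / 12 := le_trans (le_mul_of_one_le_left hcstar hL1) w2
  exact hP5_of_HFP hd2 hη L k hU₀ w1 hcs Ω Λs
    (S α₀ α₁ hα₀ hα₁ (hs.trans hc₁) U₀ U' hU₀ hU' h33 h34 hAx h135 h66)

end Adapters

/-! ## §4 THEOREM 4 AS THE ABSTRACT LEAF ON `zdGF`, modulo the fixed point in plain currency + Prop. 5 uniqueness + in-edge b9 -/

section Thm4

variable {𝔸 : Type} [CStarAlgebra 𝔸] [Nontrivial 𝔸]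

/-- **`B8.Thm4Printed (5dLB₀)` ON THE GENERAL-BACKGROUND `ℤᵈ × 𝔸` FAMILY `zdGF`, MODULO THE PROPOSITION-5 FIXED POINT IN PLAIN CURRENCY**
(Theorem 4, p. 88), for `d, L ≥ 2`, `B₀ > 0` with `2 ≤ 5dLB₀`, `B₀′ > 0`, Prop. 5's uniqueness radius `cu > 0` and a providers' threshold
`cP > 0`: the g4 leaf theorem `B8LeafModelZd.thm4Printed_zd` with its sockets `SockP5base` / `SockP5` SERVED by `SockHFP₀` / `SockHFP`
(§3, below the common threshold `min cP c₁`, `c₁` of `windows4`) and `SockH59` / `SockP5u` carried by antitonicity.  What remains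
hypothesised per member: the fixed point of (1.106)/(1.107) in plain currency (the contraction of `B8Prop5ContractionKLevel` instantiated,
№41-b), Proposition 5's uniqueness clause (1.109), and [4] Theorem 3.3 (in-edge b9).
[cite: Balaban1985RegularSpaces, Thm 4 p.88, Prop. 5 (1.106)–(1.109) p.94, pp.94–95, (1.59) p.86] -/
theorem thm4Printed_zd_of_HFP (hd2 : 2 ≤ d) {L : ℕ} (hL : 2 ≤ L) {B₀ B₀' cu cP : ℝ} (hB₀ : 0 < B₀) (hB₀' : 0 < B₀')
    (hB : 2 ≤ 5 * (d : ℝ) * L * B₀) (hcu : 0 < cu) (hcP : 0 < cP)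
    (SHFP₀ : ∀ i : ZdIdx d L, SockHFP₀ (𝔸 := 𝔸) L B₀ B₀' cP i.η i.k i.Ω i.Λs)
    (SHFP : ∀ i : ZdIdx d L, SockHFP (𝔸 := 𝔸) L B₀ B₀' cP i.η i.k i.Ω i.Λs)
    (SH59 : ∀ i : ZdIdx d L, SockH59 (𝔸 := 𝔸) L B₀ B₀' cP i.η i.k i.Ω i.Λs i.Λb)
    (SP5u : ∀ i : ZdIdx d L, SockP5u (𝔸 := 𝔸) L cP cu i.η i.k i.Ω i.Λs) :
    B8.Thm4Printed (5 * (d : ℝ) * L * B₀) (fun i : ZdIdx d L => zdGF 𝔸 L i) := by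
  have hL1 : 1 ≤ L := le_trans (by norm_num) hL
  have hd1 : 1 ≤ d := le_trans (by norm_num) hd2
  obtain ⟨c₁, hc₁, hwin⟩ := windows4 hd1 hL1 hB₀ hB₀' hB
  have hm₁ : min cP c₁ ≤ cP := min_le_left _ _
  have hwin' : ∀ α₀ α₁ : ℝ, 0 < α₀ → 0 < α₁ → α₀ + α₁ ≤ min cP c₁ →
      8 * B₀' * (5 * (d : ℝ) * L * B₀) * (α₀ + α₁) ≤ 1 / 84 ∧ L * (5 * (d : ℝ) * L * B₀ * (α₀ + α₁)) ≤ 1 / 12 ∧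
        α₁ ≤ 1 / 4 ∧ 2 * α₁ ≤ 5 * (d : ℝ) * L * B₀ * (α₀ + α₁) :=
    fun α₀ α₁ hα₀ hα₁ hs => hwin α₀ α₁ hα₀ hα₁ (hs.trans (min_le_right _ _))
  exact thm4Printed_zd hd2 hL hB₀ hB₀' hB hcu (lt_min hcP hc₁)
    (fun i => sockP5base_of_sockHFP₀ hd2 i.hη hL1 hB₀.le hm₁ hwin' (SHFP₀ i))
    (fun i => sockP5_of_sockHFP hd2 i.hη hL1 hB₀.le hm₁ hwin' (SHFP i))
    (fun i => sockH59_anti hm₁ (SH59 i)) (fun i => sockP5u_anti hm₁ (SP5u i))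

/-- **The same with four INDEPENDENT provider thresholds** (`cF₀`, `cF`, `c59`, `cu'` — each provider delivers below its own positive
constant; the leaf's `c₁` absorbs their minimum): the form in which №41-b (fixed point), the uniqueness provider and the in-edge b9
arrive. [cite: Balaban1985RegularSpaces, Thm 4 p.88 («there exists a constant c₁»), Prop. 5 p.94, (1.59) p.86] -/
theorem thm4Printed_zd_of_HFP₄ (hd2 : 2 ≤ d) {L : ℕ} (hL : 2 ≤ L) {B₀ B₀' cu cF₀ cF c59 cu' : ℝ} (hB₀ : 0 < B₀) (hB₀' : 0 < B₀')
    (hB : 2 ≤ 5 * (d : ℝ) * L * B₀) (hcu : 0 < cu) (hcF₀ : 0 < cF₀) (hcF : 0 < cF) (hc59 : 0 < c59) (hcu' : 0 < cu')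
    (SHFP₀ : ∀ i : ZdIdx d L, SockHFP₀ (𝔸 := 𝔸) L B₀ B₀' cF₀ i.η i.k i.Ω i.Λs)
    (SHFP : ∀ i : ZdIdx d L, SockHFP (𝔸 := 𝔸) L B₀ B₀' cF i.η i.k i.Ω i.Λs)
    (SH59 : ∀ i : ZdIdx d L, SockH59 (𝔸 := 𝔸) L B₀ B₀' c59 i.η i.k i.Ω i.Λs i.Λb)
    (SP5u : ∀ i : ZdIdx d L, SockP5u (𝔸 := 𝔸) L cu' cu i.η i.k i.Ω i.Λs) :
    B8.Thm4Printed (5 * (d : ℝ) * L * B₀) (fun i : ZdIdx d L => zdGF 𝔸 L i) := by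
  set cP : ℝ := min (min cF₀ cF) (min c59 cu') with hcPdef
  have hcP : 0 < cP := lt_min (lt_min hcF₀ hcF) (lt_min hc59 hcu')
  have h₁ : cP ≤ cF₀ := (min_le_left _ _).trans (min_le_left _ _)
  have h₂ : cP ≤ cF := (min_le_left _ _).trans (min_le_right _ _)
  have h₃ : cP ≤ c59 := (min_le_right _ _).trans (min_le_left _ _)
  have h₄ : cP ≤ cu' := (min_le_right _ _).trans (min_le_right _ _)
  exact thm4Printed_zd_of_HFP hd2 hL hB₀ hB₀' hB hcu hcP (fun i => sockHFP₀_anti h₁ (SHFP₀ i))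
    (fun i => sockHFP_anti h₂ (SHFP i)) (fun i => sockH59_anti h₃ (SH59 i)) (fun i => sockP5u_anti h₄ (SP5u i))

end Thm4

#print axioms sockP5base_of_sockHFP₀
#print axioms sockP5_of_sockHFP
#print axioms thm4Printed_zd_of_HFP
#print axioms thm4Printed_zd_of_HFP₄

end Literature.MathematicalPhysics.QuantumFieldTheory.Balaban1983to89.B8LeafModelZdOfHFP

end
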